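import Mathlib
import Summits.ValiantsHypothesis.ValiantsHypothesis.Theses.FifoMatching
import Summits.ValiantsHypothesis.ValiantsHypothesis.Theorems.FifoMatchingNNDivisionHardGrandResidual
import Summits.ValiantsHypothesis.ValiantsHypothesis.Theorems.FifoMatchingNNDivisionHardBlockAvoidance
import Summits.ValiantsHypothesis.ValiantsHypothesis.Theorems.FifoMatchingNNDivisionHardSplitFaceGeneric
import Summits.ValiantsHypothesis.ValiantsHypothesis.Theorems.FifoMatchingNNDivisionHardAdjacentArcTier
import Literature.Computability.AlgebraicComplexity.NestFreeMatchingPoly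
import HarnessLib

/-!
# Route FifoMatching — crux `NNDivisionHard` (stmt-ValiantsHypothesis-21181): the residual of record after the SPLIT-FACE
# rungs — grand residual ∧ block-dense ∧ prefix-shadow-non-generic ∧ adjacent-non-generic, BY NAME

Composition of the grand residual (`GrandResidual.nnDivisionHard_iff_grandResidual`: cheap ∧ torus-homogeneous ∧
window-dense ∧ deep ∧ spread ∧ undominated) with the three split-face rung families of this generation
(`BlockAvoidance.intervalAvoiding_not_certificate_qp`, `SplitFaceGeneric.prefixGeneric_not_certificate_qp`,
`AdjacentArcTier.adjacentUniqueMax_not_certificate_qp`):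

* ★ `nnDivisionHard_iff_splitResidual` — **`Theses.FifoMatching.NNDivisionHard` ⟺ for every `k, c`, eventually in `n`, every
  nonzero cofactor `h` which is (i) cheap, (ii) torus-homogeneous, (iii) window-dense, (iv) deep, (v) spread, (vi) undominated,
  (vii) BLOCK-DENSE (a variable internal to every aligned block `[2i, 2i+2b)` with `b ≥ (log₂ n + c + 2)^{6(c+1)}`),
  (viii) PREFIX-SHADOW-NON-GENERIC (for every prefix block of half-length `b ≥ (log₂ n + c + 4)^{6(c+2)}`, the `𝟙_L`-heaviest
  monomials have at least two restrictions to `L`), and (ix) ADJACENT-NON-GENERIC (no adjacent-arc degree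
  `deg_{x_{(2c',2c'+1)}}` has a unique maximiser), satisfies `2^((log₂ n + c)^c) < L₊(NN_n · h) + L₊(h)`.**

HONEST FRAMING: residual bookkeeping BY NAME; the residual stays OPEN (Hrubeš–Yehudayoff 2021 §6 Problem 2); `NNDivisionHard`,
`NNNotVP` and VP ≠ VNP are NOT proved.  No definitions, no named facts.
References: Hrubeš–Yehudayoff 2021 §6 Problem 2 [HrubesYehudayoff2021]; Jukna–Seiwert–Sergeev 2022 [JuknaSeiwertSergeev2022].
-/

noncomputable section

-- Sub = Summit single-conjunct layout: the duplicated namespace component is mandated by the tree.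
set_option linter.dupNamespace false
set_option autoImplicit false

namespace Summit.ValiantsHypothesis.ValiantsHypothesis.Theorems.FifoMatching.NNDivisionHard.SplitResidual

open MvPolynomial Finset Literature.Computability.AlgebraicComplexity
open scoped NNReal BigOperators Classical
open Summit.ValiantsHypothesis.ValiantsHypothesis.Theorems.ZeroOneTransfer.Negative (topComponent)
open Summit.ValiantsHypothesis.ValiantsHypothesis.Theorems.FifoMatching.NNLowDegreeCofactorHard (vertexDeg)
open Summit.ValiantsHypothesis.ValiantsHypothesis.Theorems.FifoMatching.NNNotVP.DivisionSplit (σ NN SuppFn freeVars)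
open Summit.ValiantsHypothesis.ValiantsHypothesis.Theorems.FifoMatching.NNDivisionHard.StackPowersQueue (blockEmb)
open Summit.ValiantsHypothesis.ValiantsHypothesis.Theorems.FifoMatching.NNDivisionHard.GrandResidual
  (nnDivisionHard_iff_grandResidual)
open Summit.ValiantsHypothesis.ValiantsHypothesis.Theorems.FifoMatching.NNDivisionHard.BlockAvoidance
  (intervalAvoiding_not_certificate_qp)
open Summit.ValiantsHypothesis.ValiantsHypothesis.Theorems.FifoMatching.NNDivisionHard.SplitFaceGeneric
  (prefixGeneric_not_certificate_qp)
open Summit.ValiantsHypothesis.ValiantsHypothesis.Theorems.FifoMatching.NNDivisionHard.AdjacentArcTier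
  (adjacentUniqueMax_not_certificate_qp)

/-- ★ **THE RESIDUAL OF RECORD after the split-face rungs, BY NAME**: `NNDivisionHard` ⟺ its cheap ∧ torus-homogeneous ∧
window-dense ∧ deep ∧ spread ∧ undominated ∧ BLOCK-DENSE ∧ PREFIX-SHADOW-NON-GENERIC ∧ ADJACENT-NON-GENERIC tier.
[cite: HrubesYehudayoff2021, §6 Problem 2] -/
theorem nnDivisionHard_iff_splitResidual :
    Summit.ValiantsHypothesis.ValiantsHypothesis.Theses.FifoMatching.NNDivisionHard ↔
      ∀ k c : ℕ, ∃ n₀ : ℕ, ∀ n ≥ n₀, ∀ h : MvPolynomial (Fin (2 * n) × Fin (2 * n)) ℝ≥0, h ≠ 0 →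
        complexity h ≤ 2 ^ ((Nat.log 2 n + c) ^ c) →
        (∀ d ∈ h.support, ∀ d' ∈ h.support, vertexDeg d = vertexDeg d') →
        (∀ d ∈ h.support, ∀ s : ℕ,
          s + (2 * ((Nat.log 2 n + c) ^ c + Nat.log 2 n + 1) ^ 6 + 12) ≤ 2 * n →
          ∃ e ∈ d.support,
            (s ≤ e.1.val ∧ e.1.val < s + (2 * ((Nat.log 2 n + c) ^ c + Nat.log 2 n + 1) ^ 6 + 12)) ∨
            (s ≤ e.2.val ∧ e.2.val < s + (2 * ((Nat.log 2 n + c) ^ c + Nat.log 2 n + 1) ^ 6 + 12))) →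
        (∀ e : ℕ, e ≤ 2 ^ ((Nat.log 2 n + k) ^ k) → homogeneousComponent e h = 0) →
        (∀ d ∈ h.support, (Nat.log 2 n + k) ^ k < d.support.card) →
        (∀ T : Finset (σ n), T.card ≤ (Nat.log 2 n + k) ^ k →
          ∃ A : Finset (σ n), SuppFn (freeVars T (NN n)) A ∧ ¬ SuppFn (freeVars T h) A) →
        -- (vii) block-dense
        (∀ i b : ℕ, i + b ≤ n → (Nat.log 2 n + c + 2) ^ (6 * (c + 1)) ≤ b →
          ∃ e ∈ h.vars, 2 * i ≤ (e.1 : ℕ) ∧ (e.1 : ℕ) < 2 * i + 2 * b ∧ 2 * i ≤ (e.2 : ℕ) ∧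
            (e.2 : ℕ) < 2 * i + 2 * b) →
        -- (viii) prefix-shadow-non-generic
        (∀ b : ℕ, ∀ hb : b ≤ n, (Nat.log 2 n + c + 4) ^ (6 * (c + 2)) ≤ b →
          ∀ μ : (Fin (2 * b) × Fin (2 * b)) →₀ ℕ,
            ∃ m ∈ (topComponent (fun e : Fin (2 * n) × Fin (2 * n) =>
                if (e.1 : ℕ) < 2 * b ∧ (e.2 : ℕ) < 2 * b then 1 else 0) h).support,
              ∃ t, m (blockEmb (Nat.mul_le_mul_left 2 hb) t) ≠ μ t) →
        -- (ix) adjacent-non-generic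
        (∀ c' : ℕ, ∀ hc : c' + 1 ≤ n, ∀ m₀ ∈ h.support, ∃ m ∈ h.support, m ≠ m₀ ∧
          m₀ (⟨2 * c', by omega⟩, ⟨2 * c' + 1, by omega⟩) ≤ m (⟨2 * c', by omega⟩, ⟨2 * c' + 1, by omega⟩)) →
        2 ^ ((Nat.log 2 n + c) ^ c) <
          complexity (nestFreeMatchingPoly n ℝ≥0 * h) + complexity h := by
  constructor
  · intro H k c
    obtain ⟨n₀, hn₀⟩ := H c
    exact ⟨n₀, fun n hn h hh _ _ _ _ _ _ _ _ _ => hn₀ n hn h hh⟩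
  · intro H
    refine nnDivisionHard_iff_grandResidual.mpr fun k c => ?_
    obtain ⟨n₀, hn₀⟩ := H k c
    obtain ⟨n₁, hn₁⟩ := intervalAvoiding_not_certificate_qp c
    obtain ⟨n₂, hn₂⟩ := prefixGeneric_not_certificate_qp c
    obtain ⟨n₃, hn₃⟩ := adjacentUniqueMax_not_certificate_qp c
    refine ⟨max (max n₀ n₁) (max n₂ n₃), fun n hn h hh h1 h2 h3 h4 h5 h6 => ?_⟩
    have hn0 : n₀ ≤ n := le_trans (le_trans (le_max_left _ _) (le_max_left _ _)) hn
    have hn1 : n₁ ≤ n := le_trans (le_trans (le_max_right _ _) (le_max_left _ _)) hn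
    have hn2 : n₂ ≤ n := le_trans (le_trans (le_max_left _ _) (le_max_right _ _)) hn
    have hn3 : n₃ ≤ n := le_trans (le_trans (le_max_right _ _) (le_max_right _ _)) hn
    by_contra hcon
    apply hcon
    apply hn₀ n hn0 h hh h1 h2 h3 h4 h5 h6
    · intro i b hib hb
      by_contra hne
      exact hcon (hn₁ n hn1 i b hib hb h hh fun e he hP => hne ⟨e, he, hP⟩)
    · intro b hb hbig μ
      by_contra hne
      refine hcon (hn₂ n hn2 b hb hbig h hh μ fun m hm t => ?_)
      by_contra hmt
      exact hne ⟨m, hm, t, hmt⟩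
    · intro c' hc m₀ hm₀
      by_contra hne
      refine hcon (hn₃ n hn3 c' hc h m₀ hm₀ fun m hm hmne => ?_)
      by_contra hlt
      exact hne ⟨m, hm, hmne, not_lt.1 hlt⟩

end Summit.ValiantsHypothesis.ValiantsHypothesis.Theorems.FifoMatching.NNDivisionHard.SplitResidual

end
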